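import Literature.Computability.Complexity.AffineHashing
import Mathlib.Algebra.Order.BigOperators.Ring.Finset
import Mathlib.Data.Real.Basic
import Mathlib.Tactic.Ring
import Mathlib.Tactic.Linarith
import Mathlib.Tactic.FieldSimp
import Mathlib.Tactic.Positivity
import HarnessLib

/-!
# Concentration of hash buckets under pairwise independence (second moment, counting form)

Trunk T-CPLX-CORE, continuation of `AffineHashing.lean` (one-point uniformity `card_filter_hash_eq`
and pairwise independence `card_filter_hash_pair` of the affine family `h_{A,b}(x) = Ax + b` over
`𝔽₂`); sibling of `SetUpperBoundAccurate.lean`, which does the same second-moment computation for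
the bucket OF A SECRET ELEMENT `z ∈ S` (`AffineHash.bucket S h z = S ∩ h⁻¹(h z)`, collisions with
`z`, 3-wise independence) — here the bucket of a FIXED TARGET `y` (`targetBucket S h y = S ∩ h⁻¹(y)`),
for which pairwise independence suffices.

**Prior art in the tree.** `StockmeyerEstimator.lean` already carries this exact computation for the
target `y = 0`, in `ℕ`/`ℤ` form: `zeroCount` (= `(targetBucket S h 0).card`), `sum_zeroCount_mul`
(first moment), `sum_zeroCount_sq_mul` (second moment), `dev`/`sum_dev_sq` (the identity
`Σ_h (2^k Y − |S|)² = |S|(2^k − 1)|ℋ|`), `badHash`/`card_badHash_mul_le` (Chebyshev, counting form).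
The delta here: arbitrary target `y`, statements over `ℝ`, an absolute deviation threshold `a`, and
the one-sided and empty-bucket corollaries the protocol analyses consume. Re-deriving the Stockmeyer
lemmas from these is left to a later pass (a bridge would import `StockmeyerEstimator.lean` and with
it `LaserHashing`/`ApproximateCounting`, which this low-level file deliberately avoids).

For a set `S ⊆ {0,1}^m` and a target `y ∈ {0,1}^k`, the bucket `S ∩ h⁻¹(y)` of a uniformly random
`h` has mean size `μ = |S|/2^k` and — the point of pairwise independence — variance
`μ(1 - 2^{-k}) ≤ μ`, so it concentrates around `μ` as soon as `μ` is large (Chebyshev). In exact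
counting form (sums over all `|ℋ|` hash functions):

* `sum_card_targetBucket` — `Σ_h |targetBucket| = |S||ℋ|/2^k`; `sum_card_targetBucket_sq` —
  `Σ_h |targetBucket|² = |S||ℋ|/2^k + |S|(|S|-1)|ℋ|/4^k`; hence `sum_targetBucket_dev_sq` —
  `Σ_h (2^k|targetBucket| - |S|)² = |S|(2^k - 1)|ℋ|`;
* `card_targetBucket_dev_mul_le` — **Chebyshev**:
  `#{h : |2^k|targetBucket| - |S|| ≥ a} · a² ≤ |S| 2^k |ℋ|`, with its one-sided forms
  `card_targetBucket_ge_mul_le` (crowded buckets) and `card_targetBucket_le_mul_le` (sparse buckets),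
  and `card_targetBucket_empty_mul_le` — `#{h : targetBucket = ∅} · |S| ≤ 2^k |ℋ|`, i.e.
  `Pr_h[no element of S hits y] ≤ 1/μ`.

These are the "adequate random hash function" facts the size-estimation protocols consume beyond
the Goldwasser–Sipser regime `μ ≤ 1`: nonempty / well-filled buckets for the canonical-answer
construction of Akavia–Goldreich–Goldwasser–Moshkovitz (§2.1 step 2, "`|h⁻¹(0^ℓ) ∩ S| < 2|S|/2^ℓ`
with overwhelmingly high probability", there claimed for poly-wise independent families; pairwise
independence already gives the `1/μ`-type bounds used in a Chebyshev-over-runs analysis), the fine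
gap of the Aiello–Håstad upper-bound protocol (`SetUpperBoundProtocol.lean` proves the coarse gap
by Markov only), and the hash-mixing estimates of Sipser–Stockmeyer counting (already instantiated
at `y = 0` in `StockmeyerEstimator.lean`, see above). Written for the bottom-up discharge plan of `Literature.Barriers.PneNP.AkaviaEtAl2006_complMemIPk`; independent of
it; Mathlib + `AffineHashing.lean` only, all proved.

## References

* [AroraBarakCC2009] S. Arora, B. Barak, *Computational Complexity: A Modern Approach*, CUP 2009,
  Def. 8.14 and Thm. 8.15 (pairwise independent families), Claim A.13 (variance of pairwise
  independent sums), Lemma A.12 (Chebyshev), Note 8.16 ("most elements of `{0,1}^k` have roughly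
  `|S|2^{-k}` preimages in `S`").
* N. Nisan, *Pseudorandom generators for space-bounded computation*, Combinatorica 12 (1992) (the
  hash mixing lemma; same second-moment computation).
* A. Akavia, O. Goldreich, S. Goldwasser, D. Moshkovitz, STOC 2006, §2.1 (protocol for the general
  case, step 2) and App. C.
-/

namespace Literature.Computability.Complexity

open Finset

namespace AffineHash

variable {m k : ℕ}

/-- The bucket of the target `y` under `h`: the elements of `S` hashing to `y`. [folklore] -/
abbrev targetBucket (S : Finset (Fin m → ZMod 2)) (h : Hash m k) (y : Fin k → ZMod 2) :
    Finset (Fin m → ZMod 2) :=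
  S.filter fun x => hash h x = y

/-- One-point uniformity in real form: `#{h | h(x) = y} = |ℋ|/2^k`. [cite: AroraBarakCC2009, Def. 8.14] -/
theorem card_filter_hash_eq_real (x : Fin m → ZMod 2) (y : Fin k → ZMod 2) :
    ((univ.filter fun h : Hash m k => hash h x = y).card : ℝ) =
      Fintype.card (Hash m k) / 2 ^ k := by
  rw [eq_div_iff (by positivity)]
  exact_mod_cast card_filter_hash_eq x y

/-- Pairwise independence in real form: for `x ≠ x'`, `#{h | h(x) = y ∧ h(x') = y'} = |ℋ|/4^k`.
[cite: AroraBarakCC2009, Thm. 8.15] -/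
theorem card_filter_hash_pair_real {x x' : Fin m → ZMod 2} (hxx' : x ≠ x') (y y' : Fin k → ZMod 2) :
    ((univ.filter fun h : Hash m k => hash h x = y ∧ hash h x' = y').card : ℝ) =
      Fintype.card (Hash m k) / (2 ^ k * 2 ^ k) := by
  rw [eq_div_iff (by positivity)]
  exact_mod_cast card_filter_hash_pair hxx' y y'

/-- **First moment**: summed over all hash functions, the bucket sizes total `|S| |ℋ| / 2^k`
(expected bucket size `μ = |S|/2^k`). [cite: AroraBarakCC2009, Thm. 8.15 / Claim A.13] -/
theorem sum_card_targetBucket (S : Finset (Fin m → ZMod 2)) (y : Fin k → ZMod 2) :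
    ∑ h : Hash m k, ((targetBucket S h y).card : ℝ) = S.card * Fintype.card (Hash m k) / 2 ^ k := by
  have hswap : ∑ h : Hash m k, ((targetBucket S h y).card : ℝ) =
      ∑ x ∈ S, ((univ.filter fun h : Hash m k => hash h x = y).card : ℝ) := by
    simp only [targetBucket, card_filter, Nat.cast_sum]
    rw [sum_comm]
  rw [hswap, sum_congr rfl fun x _ => card_filter_hash_eq_real x y, sum_const, nsmul_eq_mul]
  ring

/-- **Second moment**: summed over all hash functions, the squared bucket sizes total
`|S| |ℋ| / 2^k + |S| (|S| - 1) |ℋ| / 4^k` (diagonal by one-point uniformity, off-diagonal by pairwise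
independence). [cite: AroraBarakCC2009, Thm. 8.15 / Claim A.13] -/
theorem sum_card_targetBucket_sq (S : Finset (Fin m → ZMod 2)) (y : Fin k → ZMod 2) :
    ∑ h : Hash m k, ((targetBucket S h y).card : ℝ) ^ 2 =
      S.card * Fintype.card (Hash m k) / 2 ^ k +
        S.card * (S.card - 1 : ℝ) * Fintype.card (Hash m k) / (2 ^ k * 2 ^ k) := by
  classical
  -- expand the square as a double sum of indicators and bring the sum over `h` inside
  have hsq : ∀ h : Hash m k, ((targetBucket S h y).card : ℝ) ^ 2 =
      ∑ x ∈ S, ∑ x' ∈ S, (if hash h x = y ∧ hash h x' = y then (1 : ℝ) else 0) := by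
    intro h
    simp only [targetBucket, card_filter, Nat.cast_sum, Nat.cast_ite, Nat.cast_one, Nat.cast_zero, sq,
      sum_mul_sum]
    refine sum_congr rfl fun x _ => sum_congr rfl fun x' _ => ?_
    by_cases h1 : hash h x = y <;> by_cases h2 : hash h x' = y <;> simp [h1, h2]
  simp_rw [hsq]
  rw [sum_comm]
  simp_rw [sum_comm (s := (univ : Finset (Hash m k)))]
  -- now: Σ_{x ∈ S} Σ_{x' ∈ S} #{h | h x = y ∧ h x' = y}
  have hinner : ∀ x ∈ S, ∑ x' ∈ S, ∑ h : Hash m k,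
      (if hash h x = y ∧ hash h x' = y then (1 : ℝ) else 0) =
        Fintype.card (Hash m k) / 2 ^ k +
          (S.card - 1 : ℝ) * (Fintype.card (Hash m k) / (2 ^ k * 2 ^ k)) := by
    intro x hx
    rw [← Finset.add_sum_erase S _ hx]
    congr 1
    · -- diagonal term
      have : ∑ h : Hash m k, (if hash h x = y ∧ hash h x = y then (1 : ℝ) else 0) =
          ((univ.filter fun h : Hash m k => hash h x = y).card : ℝ) := by
        rw [card_filter, Nat.cast_sum]
        refine sum_congr rfl fun h _ => ?_
        by_cases h1 : hash h x = y <;> simp [h1]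
      rw [this, card_filter_hash_eq_real]
    · -- off-diagonal terms
      rw [show (S.card - 1 : ℝ) = ((S.erase x).card : ℝ) by
        rw [card_erase_of_mem hx, Nat.cast_sub (card_pos.2 ⟨x, hx⟩), Nat.cast_one]]
      rw [← nsmul_eq_mul, ← sum_const]
      refine sum_congr rfl fun x' hx' => ?_
      have hne : x ≠ x' := fun h => (mem_erase.1 hx').1 h.symm
      rw [← card_filter_hash_pair_real hne y y, card_filter, Nat.cast_sum]
      refine sum_congr rfl fun h _ => ?_
      by_cases h1 : hash h x = y ∧ hash h x' = y <;> simp [h1]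
  rw [sum_congr rfl hinner, sum_const, nsmul_eq_mul]
  ring

/-- **Sum of squared deviations** (variance times `|ℋ|`, scaled by `2^k`):
`Σ_h (2^k · |targetBucket| - |S|)² = |S| (2^k - 1) |ℋ|` — the cross terms vanish by pairwise
independence. [cite: AroraBarakCC2009, Claim A.13] -/
theorem sum_targetBucket_dev_sq (S : Finset (Fin m → ZMod 2)) (y : Fin k → ZMod 2) :
    ∑ h : Hash m k, ((2 : ℝ) ^ k * (targetBucket S h y).card - S.card) ^ 2 =
      S.card * ((2 : ℝ) ^ k - 1) * Fintype.card (Hash m k) := by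
  have h1 := sum_card_targetBucket (k := k) S y
  have h2 := sum_card_targetBucket_sq (k := k) S y
  have hexp : ∀ h : Hash m k, ((2 : ℝ) ^ k * (targetBucket S h y).card - S.card) ^ 2 =
      (2 : ℝ) ^ k * 2 ^ k * ((targetBucket S h y).card : ℝ) ^ 2 -
        2 * 2 ^ k * S.card * (targetBucket S h y).card + (S.card : ℝ) ^ 2 := fun h => by ring
  simp_rw [hexp]
  rw [sum_add_distrib, sum_sub_distrib, ← mul_sum, ← mul_sum, h1, h2, sum_const, card_univ,
    nsmul_eq_mul]
  have h2k : (2 : ℝ) ^ k ≠ 0 := by positivity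
  field_simp
  ring

/-- **Chebyshev for buckets, counting form**: the hash functions whose bucket deviates from its
mean `|S|/2^k` by at least `a/2^k` (`a > 0`), times `a²`, number at most `|S| 2^k |ℋ|`:
`Pr_h[|2^k |targetBucket| - |S|| ≥ a] ≤ |S| 2^k / a²`. [cite: AroraBarakCC2009, Lemma A.12] -/
theorem card_targetBucket_dev_mul_le (S : Finset (Fin m → ZMod 2)) (y : Fin k → ZMod 2) {a : ℝ}
    (ha : 0 < a) :
    ((univ.filter fun h : Hash m k =>
        a ≤ |(2 : ℝ) ^ k * (targetBucket S h y).card - S.card|).card : ℝ) * a ^ 2 ≤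
      S.card * (2 : ℝ) ^ k * Fintype.card (Hash m k) := by
  classical
  have hdev := sum_targetBucket_dev_sq (k := k) S y
  have hle : ((univ.filter fun h : Hash m k =>
      a ≤ |(2 : ℝ) ^ k * (targetBucket S h y).card - S.card|).card : ℝ) * a ^ 2 ≤
      ∑ h : Hash m k, ((2 : ℝ) ^ k * (targetBucket S h y).card - S.card) ^ 2 := by
    rw [← nsmul_eq_mul, ← sum_const]
    refine (sum_le_sum fun h hh => ?_).trans
      (sum_le_sum_of_subset_of_nonneg (filter_subset _ _) fun h _ _ => sq_nonneg _)
    have hh' := (mem_filter.1 hh).2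
    calc a ^ 2 ≤ |(2 : ℝ) ^ k * (targetBucket S h y).card - S.card| ^ 2 :=
          pow_le_pow_left₀ ha.le hh' 2
      _ = ((2 : ℝ) ^ k * (targetBucket S h y).card - S.card) ^ 2 := sq_abs _
  refine hle.trans ?_
  rw [hdev]
  have hS : (0 : ℝ) ≤ S.card := by positivity
  have hH : (0 : ℝ) ≤ Fintype.card (Hash m k) := by positivity
  nlinarith [mul_nonneg hS hH]

/-- **Empty buckets are rare for large sets**: the hash functions under which NO element of `S`
hits `y`, times `|S|`, number at most `2^k |ℋ|`: `Pr_h[targetBucket = ∅] ≤ 2^k/|S| = 1/μ`.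
(The complement of the Goldwasser–Sipser event; this second-moment form is the useful one for
`μ ≥ 1`, where `card_exists_hash_ge` is vacuous.) [folklore] -/
theorem card_targetBucket_empty_mul_le (S : Finset (Fin m → ZMod 2)) (y : Fin k → ZMod 2) :
    ((univ.filter fun h : Hash m k => targetBucket S h y = ∅).card : ℝ) * S.card ≤
      (2 : ℝ) ^ k * Fintype.card (Hash m k) := by
  classical
  rcases S.eq_empty_or_nonempty with rfl | hS
  · simp
  have hSpos : (0 : ℝ) < S.card := by exact_mod_cast card_pos.2 hS
  have h := card_targetBucket_dev_mul_le (k := k) S y hSpos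
  have hsub : (univ.filter fun h : Hash m k => targetBucket S h y = ∅) ⊆
      (univ.filter fun h : Hash m k =>
        (S.card : ℝ) ≤ |(2 : ℝ) ^ k * (targetBucket S h y).card - S.card|) := by
    intro h hh
    rw [mem_filter] at hh ⊢
    refine ⟨hh.1, ?_⟩
    rw [hh.2, card_empty, Nat.cast_zero, mul_zero, zero_sub, abs_neg, abs_of_nonneg hSpos.le]
  have hcard : ((univ.filter fun h : Hash m k => targetBucket S h y = ∅).card : ℝ) ≤
      ((univ.filter fun h : Hash m k =>
        (S.card : ℝ) ≤ |(2 : ℝ) ^ k * (targetBucket S h y).card - S.card|).card : ℝ) := by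
    exact_mod_cast card_le_card hsub
  have := mul_le_mul_of_nonneg_right hcard (sq_nonneg (S.card : ℝ))
  nlinarith [this, h]

/-- **Crowded buckets are rare for small sets** (upper tail): the hash functions whose bucket has
at least `(|S| + a)/2^k` elements, times `a²`, number at most `|S| 2^k |ℋ|`. [folklore] -/
theorem card_targetBucket_ge_mul_le (S : Finset (Fin m → ZMod 2)) (y : Fin k → ZMod 2) {a : ℝ}
    (ha : 0 < a) :
    ((univ.filter fun h : Hash m k =>
        (S.card : ℝ) + a ≤ (2 : ℝ) ^ k * (targetBucket S h y).card).card : ℝ) * a ^ 2 ≤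
      S.card * (2 : ℝ) ^ k * Fintype.card (Hash m k) := by
  classical
  refine le_trans (mul_le_mul_of_nonneg_right ?_ (sq_nonneg a)) (card_targetBucket_dev_mul_le S y ha)
  have hsub : (univ.filter fun h : Hash m k =>
        (S.card : ℝ) + a ≤ (2 : ℝ) ^ k * (targetBucket S h y).card) ⊆
      (univ.filter fun h : Hash m k => a ≤ |(2 : ℝ) ^ k * (targetBucket S h y).card - S.card|) := by
    intro h hh
    rw [mem_filter] at hh ⊢
    exact ⟨hh.1, le_abs.2 (Or.inl (by linarith [hh.2]))⟩
  exact_mod_cast card_le_card hsub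

/-- **Sparse buckets are rare for large sets** (lower tail): the hash functions whose bucket has at
most `(|S| - a)/2^k` elements, times `a²`, number at most `|S| 2^k |ℋ|`. [folklore] -/
theorem card_targetBucket_le_mul_le (S : Finset (Fin m → ZMod 2)) (y : Fin k → ZMod 2) {a : ℝ}
    (ha : 0 < a) :
    ((univ.filter fun h : Hash m k =>
        (2 : ℝ) ^ k * (targetBucket S h y).card ≤ (S.card : ℝ) - a).card : ℝ) * a ^ 2 ≤
      S.card * (2 : ℝ) ^ k * Fintype.card (Hash m k) := by
  classical
  refine le_trans (mul_le_mul_of_nonneg_right ?_ (sq_nonneg a)) (card_targetBucket_dev_mul_le S y ha)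
  have hsub : (univ.filter fun h : Hash m k =>
        (2 : ℝ) ^ k * (targetBucket S h y).card ≤ (S.card : ℝ) - a) ⊆
      (univ.filter fun h : Hash m k => a ≤ |(2 : ℝ) ^ k * (targetBucket S h y).card - S.card|) := by
    intro h hh
    rw [mem_filter] at hh ⊢
    exact ⟨hh.1, le_abs.2 (Or.inr (by linarith [hh.2]))⟩
  exact_mod_cast card_le_card hsub

end AffineHash

end Literature.Computability.Complexity
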